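import Mathlib.Analysis.SpecialFunctions.Gaussian.GaussianIntegral
import Mathlib.MeasureTheory.Integral.Pi
import Literature.MathematicalPhysics.QuantumLattice.LatticeScalarField
import HarnessLib

/-!
# The lattice `φ⁴` measure on a finite graph is a probability measure (proofs)

Sibling proof file of `LatticeScalarField.lean`. No statement is introduced or changed; this file
**discharges the named fact**
`Literature.MathematicalPhysics.QuantumLattice.isProbabilityMeasure_phi4Measure`
(`isProbabilityMeasure_phi4Measure_holds`): for a finite simple graph `G`, quartic coupling
`0 < g` and arbitrary real `κ`, `J`, the exponential tilt
`phi4Measure G g κ J = Z⁻¹ exp (−S(φ)) ∏ₓ dφₓ`, `S = phi4Action G g κ J`, of Lebesgue measure on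
`V → ℝ` is a probability measure, i.e. the partition function `Z = ∫ exp (−S(φ)) ∏ₓ dφₓ` is
finite (and positive). This is the normalisation in Glimm–Jaffe's lattice interaction measure
`dμ_δ = exp (−:P_δ:) dφ_δ / ∫ exp (−:P_δ:) dφ_δ` (Glimm–Jaffe 1987, §9.6, (9.6.8), with the
Gaussian factor (9.6.6) written out against Lebesgue measure `∏ₓ dφ_δ(x)`), for the
semibounded polynomial `P(φ) = g φ⁴ + (quadratic)`.

## The proof (stability bound: the quartic term dominates)

* `abs_pairInteraction_le`: `|∑_{xy ∈ E(G)} φₓ φ_y| ≤ #E(G) · ∑_z φ_z²` (from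
  `|φₓ φ_y| ≤ ½(φₓ² + φ_y²)`).
* `neg_phi4Action_le`: with `B = |κ| + |J| #E(G) + 1`,
  `−S(φ) ≤ ∑ₓ (−g φₓ⁴ + (B − 1) φₓ²) ≤ |V| B²/(4g) − ∑ₓ φₓ²`, since `−g s² + B s ≤ B²/(4g)`.
* `integrable_exp_neg_phi4Action`: hence `exp (−S(φ)) ≤ e^{|V| B²/(4g)} ∏ₓ e^{−φₓ²}`, a
  constant times a product of one-dimensional Gaussians, which is Lebesgue integrable on
  `V → ℝ` (Mathlib `integrable_exp_neg_mul_sq`, `Integrable.fintype_prod`); `exp (−S)` is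
  measurable (`measurable_phi4Action`).
* `isProbabilityMeasure_phi4Measure_holds`: Mathlib `isProbabilityMeasure_tilted`.

## Sources

* J. Glimm, A. Jaffe, *Quantum Physics: a functional integral point of view* (2nd ed., Springer
  1987), §9.5 (lattice fields on `R^{|Λ_δ|}` against Lebesgue measure, (9.5.x)), §9.6, eq.
  (9.6.6) and (9.6.8), p. 190 (the normalised lattice `P(φ)₂` interaction measure).
* B. Simon, *The `P(φ)₂` Euclidean (Quantum) Field Theory* (1974), §VIII (lattice
  approximation) — same elementary finiteness of the lattice partition function for a
  semibounded interaction polynomial.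
-/

open MeasureTheory Finset

namespace Literature.MathematicalPhysics.QuantumLattice

section Graph

variable {V : Type*} [Fintype V] (G : SimpleGraph V) [DecidableRel G.Adj]

/-- The nearest-neighbour pair interaction is bounded by the total square of the field:
`|∑_{{x,y} ∈ E(G)} φₓ φ_y| ≤ #E(G) · ∑_z φ_z²` (each edge contributes
`|φₓ φ_y| ≤ ½(φₓ² + φ_y²) ≤ ∑_z φ_z²`). [folklore] -/
theorem abs_pairInteraction_le (φ : V → ℝ) :
    |pairInteraction G φ| ≤ (G.edgeFinset.card : ℝ) * ∑ z, φ z ^ 2 := by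
  unfold pairInteraction
  refine (Finset.abs_sum_le_sum_abs _ _).trans ?_
  refine (Finset.sum_le_sum (g := fun _ => ∑ z, φ z ^ 2) fun e _ => ?_).trans (le_of_eq ?_)
  · induction e using Sym2.ind with
    | h x y =>
      simp only [Sym2.lift_mk]
      have hx : φ x ^ 2 ≤ ∑ z, φ z ^ 2 :=
        Finset.single_le_sum (fun z _ => sq_nonneg (φ z)) (Finset.mem_univ x)
      have hy : φ y ^ 2 ≤ ∑ z, φ z ^ 2 :=
        Finset.single_le_sum (fun z _ => sq_nonneg (φ z)) (Finset.mem_univ y)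
      rw [abs_le]
      constructor <;> nlinarith [sq_nonneg (φ x + φ y), sq_nonneg (φ x - φ y)]
  · rw [Finset.sum_const, nsmul_eq_mul]

/-- Elementary quadratic-versus-quartic bookkeeping: for `g > 0` and all real `B`, `s`,
`−g s² + B s ≤ B²/(4g)` (from `(2gs − B)² ≥ 0`). [folklore] -/
theorem neg_mul_sq_add_mul_le {g : ℝ} (hg : 0 < g) (B s : ℝ) :
    -(g * s ^ 2) + B * s ≤ B ^ 2 / (4 * g) := by
  rw [le_div_iff₀ (by positivity)]
  nlinarith [sq_nonneg (2 * g * s - B)]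

/-- **Stability bound** for the lattice `φ⁴` action ("the quartic term dominates"): for `0 < g`,
with `B = |κ| + |J| #E(G) + 1`,
`−S(φ) ≤ |V| · B²/(4g) − ∑ₓ φₓ²` for every configuration `φ`, where
`S(φ) = ∑ₓ (g φₓ⁴ + κ φₓ²) − J ∑_{xy} φₓ φ_y` is `phi4Action G g κ J`. (The semiboundedness of
the lattice interaction, Glimm–Jaffe 1987, §9.6; elementary.) [folklore] -/
theorem neg_phi4Action_le {g : ℝ} (hg : 0 < g) (κ J : ℝ) (φ : V → ℝ) :
    -phi4Action G g κ J φ ≤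
      (Fintype.card V : ℝ) * ((|κ| + |J| * (G.edgeFinset.card : ℝ) + 1) ^ 2 / (4 * g)) -
        ∑ x, φ x ^ 2 := by
  set B : ℝ := |κ| + |J| * (G.edgeFinset.card : ℝ) + 1 with hB
  have hS0 : 0 ≤ ∑ x, φ x ^ 2 := Finset.sum_nonneg fun x _ => sq_nonneg (φ x)
  -- the nearest-neighbour term against `|J| #E · ∑ φ²`
  have hpair : J * pairInteraction G φ ≤ |J| * (G.edgeFinset.card : ℝ) * ∑ x, φ x ^ 2 := by
    calc J * pairInteraction G φ ≤ |J * pairInteraction G φ| := le_abs_self _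
      _ = |J| * |pairInteraction G φ| := abs_mul _ _
      _ ≤ |J| * ((G.edgeFinset.card : ℝ) * ∑ x, φ x ^ 2) :=
          mul_le_mul_of_nonneg_left (abs_pairInteraction_le G φ) (abs_nonneg _)
      _ = |J| * (G.edgeFinset.card : ℝ) * ∑ x, φ x ^ 2 := by ring
  -- the quadratic term against `|κ| · ∑ φ²`
  have hquad : -(∑ x, κ * φ x ^ 2) ≤ |κ| * ∑ x, φ x ^ 2 := by
    rw [← Finset.mul_sum]
    have := neg_abs_le κ
    nlinarith
  -- the quartic term, site by site
  have hsite : ∀ x, -(g * φ x ^ 4) + B * φ x ^ 2 ≤ B ^ 2 / (4 * g) := fun x => by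
    have h := neg_mul_sq_add_mul_le hg B (φ x ^ 2)
    calc -(g * φ x ^ 4) + B * φ x ^ 2 = -(g * (φ x ^ 2) ^ 2) + B * φ x ^ 2 := by ring
      _ ≤ B ^ 2 / (4 * g) := h
  have hsum : -(∑ x, g * φ x ^ 4) + B * ∑ x, φ x ^ 2 ≤
      (Fintype.card V : ℝ) * (B ^ 2 / (4 * g)) := by
    have h : ∑ x, (-(g * φ x ^ 4) + B * φ x ^ 2) ≤ ∑ _x : V, B ^ 2 / (4 * g) :=
      Finset.sum_le_sum fun x _ => hsite x
    rw [Finset.sum_const, Finset.card_univ, nsmul_eq_mul, Finset.sum_add_distrib,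
      Finset.sum_neg_distrib] at h
    simpa only [← Finset.mul_sum] using h
  have hBS : B * ∑ x, φ x ^ 2 =
      |κ| * ∑ x, φ x ^ 2 + |J| * (G.edgeFinset.card : ℝ) * ∑ x, φ x ^ 2 + ∑ x, φ x ^ 2 := by
    rw [hB]; ring
  unfold phi4Action
  rw [Finset.sum_add_distrib]
  linarith [hpair, hquad, hsum, hBS]

/-- **The lattice `φ⁴` partition function is finite**: for `0 < g` and all real `κ`, `J`,
`φ ↦ exp (−S(φ))`, `S = phi4Action G g κ J`, is Lebesgue integrable on `V → ℝ`; by the stability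
bound `exp (−S(φ)) ≤ e^{C} ∏ₓ e^{−φₓ²}`, a constant times a product of one-dimensional
Gaussians. This is the finiteness of the normalisation `∫ exp (−:P_δ:) dφ_δ` of the lattice
interaction measure (Glimm–Jaffe 1987, §9.6, (9.6.6), (9.6.8)). [cite: GlimmJaffe1987, §9.6 (9.6.8)] -/
theorem integrable_exp_neg_phi4Action {g : ℝ} (hg : 0 < g) (κ J : ℝ) :
    Integrable (fun φ : V → ℝ => Real.exp (-phi4Action G g κ J φ)) := by
  obtain ⟨C, hC⟩ : ∃ C : ℝ, ∀ φ : V → ℝ, -phi4Action G g κ J φ ≤ C - ∑ x, φ x ^ 2 :=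
    ⟨_, neg_phi4Action_le G hg κ J⟩
  have hprod : Integrable (fun φ : V → ℝ => ∏ x, Real.exp (-1 * φ x ^ 2)) := by
    have h := Integrable.fintype_prod (ι := V)
      (f := fun (_ : V) (t : ℝ) => Real.exp (-1 * t ^ 2)) (μ := fun _ => (volume : Measure ℝ))
      fun _ => integrable_exp_neg_mul_sq one_pos
    rwa [← volume_pi] at h
  refine (hprod.const_mul (Real.exp C)).mono'
    (by fun_prop : Measurable fun φ : V → ℝ => Real.exp (-phi4Action G g κ J φ)).aestronglyMeasurable
    (Filter.Eventually.of_forall fun φ => ?_)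
  rw [Real.norm_of_nonneg (Real.exp_pos _).le]
  have hprodexp : ∏ x, Real.exp (-1 * φ x ^ 2) = Real.exp (-∑ x, φ x ^ 2) := by
    rw [← Finset.sum_neg_distrib, Real.exp_sum]
    exact Finset.prod_congr rfl fun x _ => by rw [neg_one_mul]
  rw [hprodexp, ← Real.exp_add, Real.exp_le_exp]
  linarith [hC φ]

/-- **Discharge of the named fact `isProbabilityMeasure_phi4Measure`.** For `0 < g` (and all
real `κ`, `J`) the lattice `φ⁴` Gibbs measure `phi4Measure G g κ J` on a finite simple graph —
the exponential tilt of Lebesgue measure on `V → ℝ` by `−phi4Action G g κ J` — is a probability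
measure, since `exp (−S)` is Lebesgue integrable (`integrable_exp_neg_phi4Action`) and Lebesgue
measure on `V → ℝ` is non-zero (Mathlib `isProbabilityMeasure_tilted`). This is the
well-definedness of the normalised lattice interaction measure
`dμ_δ = exp (−:P_δ:) dφ_δ / ∫ exp (−:P_δ:) dφ_δ` of Glimm–Jaffe 1987, §9.6, eq. (9.6.8) (with the
Gaussian density (9.6.6) against Lebesgue measure `∏ₓ dφ_δ(x)` absorbed into the action, §9.5).
[cite: GlimmJaffe1987, §9.6 (9.6.8)] -/
theorem isProbabilityMeasure_phi4Measure_holds : isProbabilityMeasure_phi4Measure G := by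
  intro g hg κ J
  unfold phi4Measure
  exact isProbabilityMeasure_tilted (integrable_exp_neg_phi4Action G hg κ J)

end Graph

end Literature.MathematicalPhysics.QuantumLattice
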